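import Summits.Schanuel.Schanuel.Theorems.RootDecomp1JBlockHulls

/-!
# The gap lemma over block-closed spaces (route `RootDecomp1J`, residual K₃ = `stmt-Schanuel-30523`)

Support file for `stmt-Schanuel-30523` (`SchanuelOverPairClosedFields = Rel(⊤|𝓚₂)`).  Unconditional;
nothing here proves Schanuel.

**THE BLOCK CRITERION** (`hblock_of_cost_le`, the modular-law induction): over a `ℚ`-subspace `E` of `ℂ`
satisfying the gap at every rank `1 ≤ c < s` (`GapOn E c`: a `c`-tuple free modulo `E` costs `≥ c + 1`
over every `E`-field `ℚ(y, e^y)`, `y ⊂ E` finite), an `s`-tuple `w` free modulo `E` of cost `≤ s` over some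
`E`-field is a HEREDITARY `s`-block over `E` (`HBlock E w`).  Proof: given a test field `ℚ(T, e^T)`,
`T ⊇ range y`, with `w ⊂ span_ℚ(T ∪ w∘ρ)`, split `span T` modulo `E + span w` (`exists_modular_split`: a
basis `b ⊂ E` of a complement of `span y` in the `E`-trace and a free-modulo-`(E + span w)` tuple `τ` with
`span y + span b + span τ + span w = span y + span T + span w`); unless `τ = ∅` the gap at the smaller rank
`|τ| < s` over the `E`-field `ℚ(y, b, e^y, e^b)` gives `trdeg ≥ |τ| + 1` for `τ`, and the tower law along
`ℚ(y,b) ⊆ ℚ(y,b,τ) ⊆ ℚ(y,b,τ,w)` squeezes the cost of `w` over `ℚ(T, e^T)` down to the number `k` of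
coordinates of `w` surviving modulo `T`.  The heredity (ALL `T ⊇ Y`, all sub-tuples) is what the
induction earns; the absolute «certificate» `trdeg ℚ(v, w, e^…) ≤ trdeg ℚ(v, e^v) + |w|` for all `v` is
false over a slack prefix and is not claimed.

**THE GAP LEMMA** (`gapOn_of_blockClosed`): consequently, over an `N`-block-closed `E` (`blockStep N E ≤ E`;
`𝓚₂ = blockHull 2 𝓚` is `2`-block-closed by `blockStep_blockHull`) every `s`-tuple with `1 ≤ s ≤ N` free
modulo `E` costs `≥ s + 1` over every `E`-field (a cheap free tuple would be a block, hence inside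
`E^{B≤N} ≤ E`, contradicting freeness) and (`blockCrit_of_blockClosed`, `s ≤ N + 1`) every free `s`-tuple
of cost `≤ s` is a hereditary `s`-block.  `gap_abs_of_blockClosed`: the absolute form over `y = ∅`.

Provenance: decomposition cell `decomp-schanuel`, lens 3, NODE v10 §33.0–§33.1 (kernel-checked there);
ported verbatim. [folklore tools; the induction is this cell's]
-/

set_option linter.dupNamespace false

noncomputable section

open Complex IntermediateField
open Literature.Barriers.Schanuel (trdeg_mono)
open Summit.Schanuel.Schanuel.Theorems.RootDecomp1DFlagSplit (trdeg_adjoin_union_eq_add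
  trdeg_adjoin_le_cardinalMk trdeg_gens_lt_aleph0 rel_iff_add disjoint_span_of_linearIndependent_mkQ
  schanuelOn_of_relOn)
open Summit.Schanuel.Schanuel.Theorems.RootDecomp1JKhovanskiiBlocks (mem_and_isAlgebraic_exp_of_mem_span
  mem_and_isAlgebraic_exp_of_mem_span_set reltrdeg_le_of_isAlgebraic trdeg_witnessField_lt_aleph0)
open Summit.Schanuel.Schanuel.Theorems.RootDecomp1JBlockHulls

namespace Summit.Schanuel.Schanuel.Theorems.RootDecomp1JGapLemma

/-! ### §1 Tools of the induction -/

set_option synthInstance.maxHeartbeats 400000 in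
/-- (private copy; landed public twin: `Literature.Barriers.Schanuel.trdeg_adjoin_union_eq_of_isAlgebraic_adjoin` in NesterenkoModularScopeConjectureProofs, not in this import cone) `trdeg_K K(S ∪ T) = trdeg_K K(S)` when `T` is algebraic over `K(S)`. [folklore] -/
private theorem trdeg_adjoin_union_eq_of_isAlgebraic {K E : Type*} [Field K] [Field E] [Algebra K E]
    (S T : Set E) (hT : ∀ x ∈ T, IsAlgebraic (adjoin K S) x) :
    Algebra.trdeg K (adjoin K (S ∪ T)) = Algebra.trdeg K (adjoin K S) := by
  have htower := trdeg_add_eq K (adjoin K S) (A := adjoin (adjoin K S) T)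
  have heq : Algebra.trdeg K (adjoin (adjoin K S) T) = Algebra.trdeg K (adjoin K (S ∪ T)) := by
    rw [← (equivOfEq (adjoin_adjoin_left K S T)).trdeg_eq]
    rfl
  haveI : Algebra.IsAlgebraic (adjoin K S) (adjoin (adjoin K S) T) :=
    IntermediateField.isAlgebraic_adjoin fun x hx => (hT x hx).isIntegral
  have h0 : Algebra.trdeg (adjoin K S) (adjoin (adjoin K S) T) = 0 := trdeg_eq_zero
  rw [h0, add_zero, heq] at htower
  exact htower.symm

/-- `trdeg ℚ ℚ(G)` is finite for finite `G`. [folklore] -/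
private theorem trdeg_adjoin_lt_aleph0_of_finite {G : Set ℂ} (hG : G.Finite) :
    Algebra.trdeg ℚ ↥(adjoin ℚ G) < Cardinal.aleph0 :=
  lt_of_le_of_lt (trdeg_adjoin_le_cardinalMk G) (Cardinal.lt_aleph0_iff_set_finite.2 hG)

/-- Upper RELATIVE count `↔` upper DIFFERENCE count over a finitely generated base:
`trdeg_{ℚ(G)} ℚ(G)(S) ≤ m ↔ trdeg ℚ(G ∪ S) ≤ trdeg ℚ(G) + m`. [folklore; twin of `rel_iff_add`] -/
theorem rel_le_iff_add (G S : Set ℂ) (hG : Algebra.trdeg ℚ ↥(adjoin ℚ G) < Cardinal.aleph0) (m : ℕ) :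
    Algebra.trdeg ↥(adjoin ℚ G) ↥(adjoin ↥(adjoin ℚ G) S) ≤ (m : Cardinal) ↔
      Algebra.trdeg ℚ ↥(adjoin ℚ (G ∪ S)) ≤ Algebra.trdeg ℚ ↥(adjoin ℚ G) + m := by
  have htower : Algebra.trdeg ℚ ↥(adjoin ℚ (G ∪ S)) =
      Algebra.trdeg ℚ ↥(adjoin ℚ G) + Algebra.trdeg ↥(adjoin ℚ G) ↥(adjoin ↥(adjoin ℚ G) S) :=
    trdeg_adjoin_union_eq_add (K := ℚ) G S
  obtain ⟨c, hc⟩ := Cardinal.lt_aleph0.1 hG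
  constructor
  · intro h
    calc Algebra.trdeg ℚ ↥(adjoin ℚ (G ∪ S))
        = Algebra.trdeg ℚ ↥(adjoin ℚ G) + Algebra.trdeg ↥(adjoin ℚ G) ↥(adjoin ↥(adjoin ℚ G) S) :=
          htower
      _ ≤ Algebra.trdeg ℚ ↥(adjoin ℚ G) + (m : Cardinal) := add_le_add le_rfl h
  · intro h
    have h' : Algebra.trdeg ↥(adjoin ℚ G) ↥(adjoin ↥(adjoin ℚ G) S) + (c : Cardinal) ≤
        (m : Cardinal) + (c : Cardinal) := by
      calc Algebra.trdeg ↥(adjoin ℚ G) ↥(adjoin ↥(adjoin ℚ G) S) + (c : Cardinal)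
          = Algebra.trdeg ℚ ↥(adjoin ℚ G) +
              Algebra.trdeg ↥(adjoin ℚ G) ↥(adjoin ↥(adjoin ℚ G) S) := by rw [hc, add_comm]
        _ = Algebra.trdeg ℚ ↥(adjoin ℚ (G ∪ S)) := htower.symm
        _ ≤ Algebra.trdeg ℚ ↥(adjoin ℚ G) + m := h
        _ = (m : Cardinal) + (c : Cardinal) := by rw [hc, add_comm]
    exact (Cardinal.add_nat_le_add_nat_iff c).1 h'

/-- If every `τ i ∈ span_ℚ A` then `τ i` and `e^{τ i}` are algebraic over every field `F ⊇ ℚ(A, e^A)`.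
[folklore] -/
theorem isAlgebraic_gens_of_mem_span_set {A : Set ℂ} {c : ℕ} {τ : Fin c → ℂ}
    (hτ : ∀ i, τ i ∈ Submodule.span ℚ A) (F : IntermediateField ℚ ℂ)
    (hF : adjoin ℚ (A ∪ cexp '' A) ≤ F) :
    ∀ u ∈ Set.range τ ∪ Set.range (cexp ∘ τ), IsAlgebraic F u := by
  rintro u (⟨i, rfl⟩ | ⟨i, rfl⟩)
  · exact isAlgebraic_algebraMap
      (⟨τ i, (mem_and_isAlgebraic_exp_of_mem_span_set (hτ i) F hF).1⟩ : F)
  · exact (mem_and_isAlgebraic_exp_of_mem_span_set (hτ i) F hF).2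

/-- Tuple form of `isAlgebraic_gens_of_mem_span_set`. [folklore] -/
theorem isAlgebraic_gens_of_mem_span {ι : Type*} (v : ι → ℂ) {c : ℕ} {τ : Fin c → ℂ}
    (hτ : ∀ i, τ i ∈ Submodule.span ℚ (Set.range v)) (F : IntermediateField ℚ ℂ)
    (hF : adjoin ℚ (Set.range v ∪ Set.range (cexp ∘ v)) ≤ F) :
    ∀ u ∈ Set.range τ ∪ Set.range (cexp ∘ τ), IsAlgebraic F u := by
  refine isAlgebraic_gens_of_mem_span_set hτ F ?_
  rw [← Set.range_comp]
  exact hF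

open Submodule in
/-- A free sub-system of a tuple free modulo `E` is free modulo `E`. [linear algebra] -/
theorem linearIndependent_mkQ_of_mem_span {E : Submodule ℚ ℂ} {s c : ℕ} {w : Fin s → ℂ}
    (hw : LinearIndependent ℚ (E.mkQ ∘ w)) {τ : Fin c → ℂ} (hτ : LinearIndependent ℚ τ)
    (hτV : ∀ i, τ i ∈ span ℚ (Set.range w)) : LinearIndependent ℚ (E.mkQ ∘ τ) := by
  refine hτ.map ?_
  rw [ker_mkQ]
  exact (disjoint_span_of_linearIndependent_mkQ E hw).mono_left
    (span_le.mpr (Set.range_subset_iff.mpr hτV))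

/-- Relative cost is monotone under passing to a sub-tuple. [folklore] -/
theorem reltrdeg_comp_le (K : IntermediateField ℚ ℂ) {m m' : ℕ} (z : Fin m → ℂ) (σ : Fin m' → Fin m) :
    Algebra.trdeg K ↥(adjoin K (Set.range (z ∘ σ) ∪ Set.range (cexp ∘ (z ∘ σ)))) ≤
      Algebra.trdeg K ↥(adjoin K (Set.range z ∪ Set.range (cexp ∘ z))) :=
  trdeg_mono (adjoin.mono _ _ _ (Set.union_subset_union (Set.range_comp_subset_range σ z)
    (Set.range_comp_subset_range σ (cexp ∘ z))))

open Submodule in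
/-- **Modular selection.** If `w` is `ℚ`-free and every `w j` is a `ℚ`-combination of `T` and of the
sub-tuple `w ∘ ρ` (`ρ : Fin k' → Fin s`), then `span w = span b ⊕ span τ` with `b ⊂ span w` of length
`u ≤ k'`, `τ ⊂ span w ∩ span T` free of length `c`, and `u + c = s`. [linear algebra: the modular law
`span w = span (w ∘ ρ) ⊔ (span w ⊓ span T)`] -/
theorem exists_modular_split {s k' : ℕ} {w : Fin s → ℂ} (hw : LinearIndependent ℚ w) (T : Set ℂ)
    (ρ : Fin k' → Fin s) (hspan : ∀ j, w j ∈ span ℚ (T ∪ Set.range (w ∘ ρ))) :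
    ∃ (u c : ℕ) (b : Fin u → ℂ) (τ : Fin c → ℂ), u + c = s ∧ u ≤ k' ∧
      (∀ i, b i ∈ span ℚ (Set.range w)) ∧ (∀ i, τ i ∈ span ℚ T) ∧
      (∀ i, τ i ∈ span ℚ (Set.range w)) ∧ LinearIndependent ℚ τ ∧
      (∀ j, w j ∈ span ℚ (Set.range b ∪ Set.range τ)) := by
  classical
  set V : Submodule ℚ ℂ := span ℚ (Set.range w) with hV
  set U : Submodule ℚ ℂ := span ℚ (Set.range (w ∘ ρ)) with hU
  set ST : Submodule ℚ ℂ := span ℚ T with hST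
  haveI : FiniteDimensional ℚ V := FiniteDimensional.span_of_finite ℚ (Set.finite_range w)
  haveI : FiniteDimensional ℚ U := FiniteDimensional.span_of_finite ℚ (Set.finite_range _)
  have hUV : U ≤ V := span_mono (Set.range_comp_subset_range ρ w)
  set V' : Submodule ℚ ℂ := V ⊓ ST with hV'
  haveI : FiniteDimensional ℚ V' := Submodule.finiteDimensional_of_le inf_le_left
  -- `V ≤ ST ⊔ U`, hence the modular identity `U ⊔ V' = V`
  have hVsub : V ≤ ST ⊔ U := by
    refine span_le.mpr ?_
    rintro _ ⟨j, rfl⟩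
    have h := hspan j
    rw [span_union] at h
    exact h
  have hmod : U ⊔ V' = V := by
    refine le_antisymm (sup_le hUV inf_le_left) fun v hv => ?_
    obtain ⟨t, ht, u', hu', rfl⟩ := mem_sup.1 (hVsub hv)
    have htV : t ∈ V := by
      have h1 := V.sub_mem hv (hUV hu')
      rwa [add_sub_cancel_right] at h1
    exact mem_sup.2 ⟨u', hu', t, ⟨htV, ht⟩, add_comm _ _⟩
  -- a complement `C` of `U ⊓ V'` inside `V'`; then `V = U ⊕ C`
  obtain ⟨C, hCV', hWC, hdisj⟩ := exists_compl_in (inf_le_right : U ⊓ V' ≤ V')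
  haveI : FiniteDimensional ℚ C := Submodule.finiteDimensional_of_le (hCV'.trans inf_le_left)
  have hUC_sup : U ⊔ C = V := by
    have h1 : U ⊔ C = U ⊔ V' := by
      conv_rhs => rw [← hWC]
      rw [← sup_assoc, sup_eq_left.2 (inf_le_left : U ⊓ V' ≤ U)]
    rw [h1, hmod]
  have hUC_disj : Disjoint U C := by
    rw [disjoint_def]
    intro x hxU hxC
    exact (disjoint_def.1 hdisj) x ⟨hxU, hCV' hxC⟩ hxC
  -- dimensions
  have hdim : Module.finrank ℚ U + Module.finrank ℚ C = s := by
    have h1 := Submodule.finrank_sup_add_finrank_inf_eq U C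
    rw [hUC_disj.eq_bot, finrank_bot, add_zero, hUC_sup] at h1
    rw [← h1, hV, finrank_span_eq_card hw, Fintype.card_fin]
  have hUk : Module.finrank ℚ U ≤ k' :=
    (finrank_range_le_card (R := ℚ) (w ∘ ρ)).trans_eq (Fintype.card_fin k')
  -- bases
  obtain ⟨b, hbU, -, hbspan⟩ := exists_fin_basis U
  obtain ⟨τ, hτC, hτli, hτspan⟩ := exists_fin_basis C
  refine ⟨_, _, b, τ, hdim, hUk, fun i => hUV (hbU i),
    fun i => (show τ i ∈ V ⊓ ST from hCV' (hτC i)).2,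
    fun i => (show τ i ∈ V ⊓ ST from hCV' (hτC i)).1, hτli, fun j => ?_⟩
  rw [span_union, hbspan, hτspan, hUC_sup]
  exact subset_span ⟨j, rfl⟩

/-! ### §2 The block criterion and the gap lemma -/

open Submodule in
/-- **BLOCK CRITERION, inductive step.** If the gap holds over `E` at every length `1 ≤ c < s`, then a
`ℚ`-free-modulo-`E` `s`-tuple `w` of cost `≤ s` over `K = ℚ(y, e^y)`, `y ⊂ E`, is a hereditary
`s`-block over `E` with witness set `{y}`. Given `T ⊇ {y}` and `ρ` with `w ⊂ span_ℚ(T ∪ w∘ρ)`: split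
`span w = span b ⊕ span τ` (`exists_modular_split`, `|b| = u ≤ |ρ|`, `τ ⊂ span T` free modulo `E`,
`|τ| = c`); then `trdeg ℚ(y,w,e^…) = trdeg ℚ(y,τ,b,e^…) ≤ trdeg ℚ(y,e^y) + s` and the gap
`trdeg ℚ(y,τ,e^…) ≥ trdeg ℚ(y,e^y) + c` give `trdeg_{ℚ(y,τ,e^…)}(b, e^b) ≤ u`; base change to
`ℚ(T,τ,e^…) ⊇ ℚ(y,τ,e^…)` and `trdeg ℚ(T,τ,e^…) = trdeg ℚ(T,e^T)` (`τ ⊂ span T`) give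
`trdeg ℚ(T,w,e^…) ≤ trdeg ℚ(T,τ,b,e^…) ≤ trdeg ℚ(T,e^T) + u ≤ trdeg ℚ(T,e^T) + |ρ|`. -/
theorem hblock_of_cost_le {E : Submodule ℚ ℂ} {s : ℕ} (hgap : ∀ c, 1 ≤ c → c < s → GapOn E c)
    {k : ℕ} {y : Fin k → ℂ} {w : Fin s → ℂ} (hy : ∀ i, y i ∈ E)
    (hw : LinearIndependent ℚ (E.mkQ ∘ w))
    (hcost : Algebra.trdeg ↥(adjoin ℚ (Set.range y ∪ Set.range (cexp ∘ y)))
      ↥(adjoin ↥(adjoin ℚ (Set.range y ∪ Set.range (cexp ∘ y))) (Set.range w ∪ Set.range (cexp ∘ w))) ≤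
      (s : Cardinal)) :
    HBlock E w := by
  classical
  refine ⟨Finset.univ.image y, ?_, fun T hYT k' ρ hspan => ?_⟩
  · intro t ht
    obtain ⟨i, -, rfl⟩ := Finset.mem_image.mp (Finset.mem_coe.mp ht)
    exact hy i
  set Gy := Set.range y ∪ Set.range (cexp ∘ y) with hGy
  set Sw := Set.range w ∪ Set.range (cexp ∘ w) with hSw
  set GT : Set ℂ := (↑T : Set ℂ) ∪ cexp '' ↑T with hGT
  have hfinY : Algebra.trdeg ℚ ↥(adjoin ℚ Gy) < Cardinal.aleph0 := trdeg_gens_lt_aleph0 y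
  have hfinT : Algebra.trdeg ℚ ↥(adjoin ℚ GT) < Cardinal.aleph0 := trdeg_witnessField_lt_aleph0 T
  have hw_li : LinearIndependent ℚ w := LinearIndependent.of_comp E.mkQ hw
  -- (1) modular selection
  obtain ⟨u, c, b, τ, huc, huk, hbV, hτT, hτV, hτli, hwbτ⟩ :=
    exists_modular_split hw_li (↑T) ρ hspan
  set Sb := Set.range b ∪ Set.range (cexp ∘ b) with hSb
  set Sτ := Set.range τ ∪ Set.range (cexp ∘ τ) with hSτ
  have hτ_free : LinearIndependent ℚ (E.mkQ ∘ τ) := linearIndependent_mkQ_of_mem_span hw hτli hτV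
  -- (2) `y ⊆ T`
  have hyT : ∀ i, y i ∈ (↑T : Set ℂ) := fun i =>
    Finset.mem_coe.mpr (hYT (Finset.mem_image_of_mem y (Finset.mem_univ i)))
  have hGyT : Gy ⊆ GT := by
    rintro x (⟨i, rfl⟩ | ⟨i, rfl⟩)
    · exact Or.inl (hyT i)
    · exact Or.inr ⟨y i, hyT i, rfl⟩
  -- (3) algebraicity: `b, τ, e^b, e^τ / ℚ(y, w, e^…)`; `w, e^w / ℚ(G, τ, b, e^…)`; `τ, e^τ / ℚ(T, e^T)`
  have hSw_le : ∀ G : Set ℂ, adjoin ℚ Sw ≤ adjoin ℚ (G ∪ Sw) := fun G =>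
    adjoin.mono _ _ _ Set.subset_union_right
  have halg_bτ : ∀ x ∈ Sb ∪ Sτ, IsAlgebraic (adjoin ℚ (Gy ∪ Sw)) x := by
    rintro x (hx | hx)
    · exact isAlgebraic_gens_of_mem_span w hbV _ (hSw_le Gy) x hx
    · exact isAlgebraic_gens_of_mem_span w hτV _ (hSw_le Gy) x hx
  have hbτ_sub : ∀ G : Set ℂ,
      (Set.range b ∪ Set.range τ) ∪ cexp '' (Set.range b ∪ Set.range τ) ⊆ (G ∪ Sτ) ∪ Sb := by
    intro G
    rintro x ((⟨i, rfl⟩ | ⟨i, rfl⟩) | ⟨v, (⟨i, rfl⟩ | ⟨i, rfl⟩), rfl⟩)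
    · exact Or.inr (Or.inl ⟨i, rfl⟩)
    · exact Or.inl (Or.inr (Or.inl ⟨i, rfl⟩))
    · exact Or.inr (Or.inr ⟨i, rfl⟩)
    · exact Or.inl (Or.inr (Or.inr ⟨i, rfl⟩))
  have halg_w : ∀ G : Set ℂ, ∀ x ∈ Sw, IsAlgebraic (adjoin ℚ ((G ∪ Sτ) ∪ Sb)) x := fun G =>
    isAlgebraic_gens_of_mem_span_set hwbτ _ (adjoin.mono _ _ _ (hbτ_sub G))
  have halg_τT : ∀ x ∈ Sτ, IsAlgebraic (adjoin ℚ GT) x :=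
    isAlgebraic_gens_of_mem_span_set hτT _ le_rfl
  -- (4) transcendence degrees over `ℚ`
  -- (the `Algebra ℚ ↥(adjoin ℚ _)` instance paths of the generic lemmas are only defeq: `calc`, not `rw`)
  have hset : (Gy ∪ Sw) ∪ (Sb ∪ Sτ) = ((Gy ∪ Sτ) ∪ Sb) ∪ Sw := by
    ext x; simp only [Set.mem_union]; tauto
  have e1 : Algebra.trdeg ℚ ↥(adjoin ℚ (Gy ∪ Sw)) = Algebra.trdeg ℚ ↥(adjoin ℚ ((Gy ∪ Sτ) ∪ Sb)) :=
    calc Algebra.trdeg ℚ ↥(adjoin ℚ (Gy ∪ Sw))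
        = Algebra.trdeg ℚ ↥(adjoin ℚ ((Gy ∪ Sw) ∪ (Sb ∪ Sτ))) :=
          (trdeg_adjoin_union_eq_of_isAlgebraic (Gy ∪ Sw) (Sb ∪ Sτ) halg_bτ).symm
      _ = Algebra.trdeg ℚ ↥(adjoin ℚ (((Gy ∪ Sτ) ∪ Sb) ∪ Sw)) := by rw [hset]
      _ = Algebra.trdeg ℚ ↥(adjoin ℚ ((Gy ∪ Sτ) ∪ Sb)) :=
          trdeg_adjoin_union_eq_of_isAlgebraic ((Gy ∪ Sτ) ∪ Sb) Sw (halg_w Gy)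
  have e2 : Algebra.trdeg ℚ ↥(adjoin ℚ (GT ∪ Sw)) ≤ Algebra.trdeg ℚ ↥(adjoin ℚ ((GT ∪ Sτ) ∪ Sb)) :=
    calc Algebra.trdeg ℚ ↥(adjoin ℚ (GT ∪ Sw))
        ≤ Algebra.trdeg ℚ ↥(adjoin ℚ (((GT ∪ Sτ) ∪ Sb) ∪ Sw)) :=
          trdeg_mono (adjoin.mono _ _ _ (Set.union_subset_union_left _
            (Set.subset_union_left.trans Set.subset_union_left)))
      _ = Algebra.trdeg ℚ ↥(adjoin ℚ ((GT ∪ Sτ) ∪ Sb)) :=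
          trdeg_adjoin_union_eq_of_isAlgebraic ((GT ∪ Sτ) ∪ Sb) Sw (halg_w GT)
  have e3 : Algebra.trdeg ℚ ↥(adjoin ℚ (GT ∪ Sτ)) = Algebra.trdeg ℚ ↥(adjoin ℚ GT) :=
    trdeg_adjoin_union_eq_of_isAlgebraic GT Sτ halg_τT
  have t1 := trdeg_adjoin_union_eq_add (K := ℚ) (Gy ∪ Sτ) Sb
  have t2 := trdeg_adjoin_union_eq_add (K := ℚ) (GT ∪ Sτ) Sb
  have bc : Algebra.trdeg ↥(adjoin ℚ (GT ∪ Sτ)) ↥(adjoin ↥(adjoin ℚ (GT ∪ Sτ)) Sb) ≤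
      Algebra.trdeg ↥(adjoin ℚ (Gy ∪ Sτ)) ↥(adjoin ↥(adjoin ℚ (Gy ∪ Sτ)) Sb) :=
    Literature.NumberTheory.Transcendental.trdeg_adjoin_le_of_le
      (adjoin.mono _ _ _ (Set.union_subset_union_left _ hGyT)) Sb
  -- (5) the cost of `(b, e^b)` over `ℚ(T, τ, e^T, e^τ)` is `≤ u`
  have hcost' : Algebra.trdeg ℚ ↥(adjoin ℚ (Gy ∪ Sw)) ≤
      Algebra.trdeg ℚ ↥(adjoin ℚ Gy) + (s : Cardinal) := (rel_le_iff_add Gy Sw hfinY s).1 hcost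
  have hr : Algebra.trdeg ↥(adjoin ℚ (GT ∪ Sτ)) ↥(adjoin ↥(adjoin ℚ (GT ∪ Sτ)) Sb) ≤ (u : Cardinal) := by
    rcases Nat.eq_zero_or_pos u with hu | hu
    · subst hu
      have hSb0 : Sb = ∅ := by rw [hSb]; simp [Set.range_eq_empty]
      calc Algebra.trdeg ↥(adjoin ℚ (GT ∪ Sτ)) ↥(adjoin ↥(adjoin ℚ (GT ∪ Sτ)) Sb)
          ≤ Cardinal.mk Sb := trdeg_adjoin_le_cardinalMk _
        _ = 0 := by rw [hSb0]; exact Cardinal.mk_eq_zero _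
        _ ≤ ((0 : ℕ) : Cardinal) := by simp
    · have hIH : Algebra.trdeg ℚ ↥(adjoin ℚ Gy) + (c : Cardinal) ≤
          Algebra.trdeg ℚ ↥(adjoin ℚ (Gy ∪ Sτ)) := by
        rcases Nat.eq_zero_or_pos c with hc | hc
        · rw [hc, Nat.cast_zero, add_zero]
          exact trdeg_mono (adjoin.mono _ _ _ Set.subset_union_left)
        · have hg := (rel_iff_add Gy Sτ hfinY (c + 1)).1 (hgap c hc (by omega) k y τ hy hτ_free)
          exact le_trans (add_le_add le_rfl (by exact_mod_cast Nat.le_succ c)) hg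
      obtain ⟨d, hd⟩ := Cardinal.lt_aleph0.1 hfinY
      have key : Algebra.trdeg ↥(adjoin ℚ (Gy ∪ Sτ)) ↥(adjoin ↥(adjoin ℚ (Gy ∪ Sτ)) Sb) +
          ((c + d : ℕ) : Cardinal) ≤ (u : Cardinal) + ((c + d : ℕ) : Cardinal) := by
        calc Algebra.trdeg ↥(adjoin ℚ (Gy ∪ Sτ)) ↥(adjoin ↥(adjoin ℚ (Gy ∪ Sτ)) Sb) +
              ((c + d : ℕ) : Cardinal)
            = (Algebra.trdeg ℚ ↥(adjoin ℚ Gy) + (c : Cardinal)) +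
                Algebra.trdeg ↥(adjoin ℚ (Gy ∪ Sτ)) ↥(adjoin ↥(adjoin ℚ (Gy ∪ Sτ)) Sb) := by
              rw [hd]; push_cast; ring
          _ ≤ Algebra.trdeg ℚ ↥(adjoin ℚ (Gy ∪ Sτ)) +
                Algebra.trdeg ↥(adjoin ℚ (Gy ∪ Sτ)) ↥(adjoin ↥(adjoin ℚ (Gy ∪ Sτ)) Sb) :=
              add_le_add hIH le_rfl
          _ = Algebra.trdeg ℚ ↥(adjoin ℚ ((Gy ∪ Sτ) ∪ Sb)) := t1.symm
          _ = Algebra.trdeg ℚ ↥(adjoin ℚ (Gy ∪ Sw)) := e1.symm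
          _ ≤ Algebra.trdeg ℚ ↥(adjoin ℚ Gy) + (s : Cardinal) := hcost'
          _ = (u : Cardinal) + ((c + d : ℕ) : Cardinal) := by rw [hd, ← huc]; push_cast; ring
      exact bc.trans ((Cardinal.add_nat_le_add_nat_iff (c + d)).1 key)
  -- (6) conclusion over the witness field `ℚ(T, e^T)`
  refine (rel_le_iff_add GT Sw hfinT k').2 ?_
  calc Algebra.trdeg ℚ ↥(adjoin ℚ (GT ∪ Sw))
      ≤ Algebra.trdeg ℚ ↥(adjoin ℚ ((GT ∪ Sτ) ∪ Sb)) := e2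
    _ = Algebra.trdeg ℚ ↥(adjoin ℚ (GT ∪ Sτ)) +
          Algebra.trdeg ↥(adjoin ℚ (GT ∪ Sτ)) ↥(adjoin ↥(adjoin ℚ (GT ∪ Sτ)) Sb) := t2
    _ ≤ Algebra.trdeg ℚ ↥(adjoin ℚ GT) + (u : Cardinal) := by rw [e3]; exact add_le_add le_rfl hr
    _ ≤ Algebra.trdeg ℚ ↥(adjoin ℚ GT) + (k' : Cardinal) :=
        add_le_add le_rfl (by exact_mod_cast huk)

/-- **Gap from the criterion.** Over an `N`-block-closed space the block criterion at length
`1 ≤ s ≤ N` forces the gap at length `s`: a free `s`-tuple of cost `≤ s` would be a block, whose first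
coordinate lies in `E^{B≤N} ≤ E` — contradicting freeness. -/
theorem gapOn_of_blockCrit {N : ℕ} {E : Submodule ℚ ℂ} (hE : blockStep N E ≤ E) {s : ℕ} (hs1 : 1 ≤ s)
    (hsN : s ≤ N) (hB : BlockCrit E s) : GapOn E s := by
  intro k y w hy hw
  by_contra hlt
  rw [not_le] at hlt
  obtain ⟨t, ht⟩ := Cardinal.lt_aleph0.1 (hlt.trans (Cardinal.natCast_lt_aleph0))
  rw [ht] at hlt
  have hts : t < s + 1 := by exact_mod_cast hlt
  have hle : Algebra.trdeg ↥(adjoin ℚ (Set.range y ∪ Set.range (cexp ∘ y)))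
      ↥(adjoin ↥(adjoin ℚ (Set.range y ∪ Set.range (cexp ∘ y))) (Set.range w ∪ Set.range (cexp ∘ w))) ≤
      (s : Cardinal) := by
    rw [ht]; exact_mod_cast Nat.lt_succ_iff.1 hts
  have hblk : HBlock E w := hB k y w hy hw hle
  have h0 : w ⟨0, hs1⟩ ∈ E := hE (mem_blockStep_of_hblock hsN hblk ⟨0, hs1⟩)
  have h1 : (E.mkQ ∘ w) ⟨0, hs1⟩ = 0 := by
    simpa using (Submodule.Quotient.mk_eq_zero E).mpr h0
  exact hw.ne_zero _ h1

/-- The simultaneous induction: criterion at every length `≤ N + 1`, gap at every length `1 ≤ s ≤ N`. -/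
theorem blockCrit_and_gapOn {N : ℕ} {E : Submodule ℚ ℂ} (hE : blockStep N E ≤ E) (s : ℕ) :
    (s ≤ N + 1 → BlockCrit E s) ∧ (1 ≤ s → s ≤ N → GapOn E s) := by
  induction s using Nat.strong_induction_on with
  | _ s ih =>
    have hB : s ≤ N + 1 → BlockCrit E s := fun hs k y w hy hw hcost =>
      hblock_of_cost_le (fun c hc1 hcs => (ih c hcs).2 hc1 (by omega)) hy hw hcost
    exact ⟨hB, fun hs1 hsN => gapOn_of_blockCrit hE hs1 hsN (hB (by omega))⟩

/-- **THE GAP LEMMA.** Over an `N`-block-closed space `E`, for `y ⊂ E` and `τ` `ℚ`-free modulo `E` of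
length `1 ≤ s ≤ N`: `trdeg_{ℚ(y,e^y)} ℚ(y,e^y)(τ, e^τ) ≥ s + 1`. -/
theorem gapOn_of_blockClosed {N : ℕ} {E : Submodule ℚ ℂ} (hE : blockStep N E ≤ E) {s : ℕ}
    (hs1 : 1 ≤ s) (hsN : s ≤ N) : GapOn E s :=
  (blockCrit_and_gapOn hE s).2 hs1 hsN

/-- **THE BLOCK CRITERION.** Over an `N`-block-closed space `E`, a `ℚ`-free-modulo-`E` tuple of length
`s ≤ N + 1` and cost `≤ s` over an `E`-field is a hereditary `s`-block over `E`. -/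
theorem blockCrit_of_blockClosed {N : ℕ} {E : Submodule ℚ ℂ} (hE : blockStep N E ≤ E) {s : ℕ}
    (hs : s ≤ N + 1) : BlockCrit E s :=
  (blockCrit_and_gapOn hE s).1 hs

/-- Absolute form of the gap lemma (empty base): a `ℚ`-free-modulo-`E` tuple `τ` of length
`1 ≤ s ≤ N`, `E` `N`-block-closed, has `trdeg ℚ(τ, e^τ) ≥ s + 1`. -/
theorem gap_abs_of_blockClosed {N : ℕ} {E : Submodule ℚ ℂ} (hE : blockStep N E ≤ E) {s : ℕ}
    (hs1 : 1 ≤ s) (hsN : s ≤ N) {τ : Fin s → ℂ} (hτ : LinearIndependent ℚ (E.mkQ ∘ τ)) :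
    ((s + 1 : ℕ) : Cardinal) ≤ Algebra.trdeg ℚ ↥(adjoin ℚ (Set.range τ ∪ Set.range (cexp ∘ τ))) := by
  have h := gapOn_of_blockClosed hE hs1 hsN 0 (Fin.elim0 : Fin 0 → ℂ) τ (fun i => i.elim0) hτ
  have hG0 : Set.range (Fin.elim0 : Fin 0 → ℂ) ∪ Set.range (cexp ∘ (Fin.elim0 : Fin 0 → ℂ)) =
      (∅ : Set ℂ) := by
    simp [Set.range_eq_empty]
  have hfin := trdeg_gens_lt_aleph0 (Fin.elim0 : Fin 0 → ℂ)
  have h2 := (rel_iff_add _ _ hfin (s + 1)).1 h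
  have h0 : Algebra.trdeg ℚ ↥(adjoin ℚ (Set.range (Fin.elim0 : Fin 0 → ℂ) ∪
      Set.range (cexp ∘ (Fin.elim0 : Fin 0 → ℂ)))) = 0 := by
    refine nonpos_iff_eq_zero.1 ?_
    calc Algebra.trdeg ℚ ↥(adjoin ℚ (Set.range (Fin.elim0 : Fin 0 → ℂ) ∪
          Set.range (cexp ∘ (Fin.elim0 : Fin 0 → ℂ))))
        ≤ Cardinal.mk ↥(Set.range (Fin.elim0 : Fin 0 → ℂ) ∪ Set.range (cexp ∘ (Fin.elim0 : Fin 0 → ℂ))) :=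
          trdeg_adjoin_le_cardinalMk _
      _ = 0 := by rw [hG0]; exact Cardinal.mk_eq_zero _
  rw [h0, zero_add, hG0, Set.empty_union] at h2
  exact h2

end Summit.Schanuel.Schanuel.Theorems.RootDecomp1JGapLemma

end
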